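import Summits.RiemannHypothesis.RiemannHypothesis.Theorems.EvenSectorBartaEvenOneSignedWindowsSourceL2Bound
import Summits.RiemannHypothesis.RiemannHypothesis.Theorems.GroundBartaPolarPerronFrobeniusSourceCofinal
import Summits.RiemannHypothesis.RiemannHypothesis.Theorems.GroundBartaPolarPerronFrobeniusEvenSectorEulerLagrange
import Summits.RiemannHypothesis.RiemannHypothesis.Theorems.GroundBartaPolarPerronFrobeniusAeNonnegOfL2Limit
import Summits.RiemannHypothesis.RiemannHypothesis.Theorems.EvenSectorBartaEvenOneSignedWindowsContinuity
import Summits.RiemannHypothesis.RiemannHypothesis.Theorems.OddSectorOddOneSignedWindowsRealPart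
import Literature.NumberTheory.LFunctions.WeilSemilocalCompactnessProofs
import HarnessLib

/-!
# THE L²-SOURCE CERTIFICATE LEMMA: an explicit non-negative profile + an L² radius ⇒ a one-signed even-sector window
(crux `EvenSectorBarta.EvenOneSignedWindows`, item stmt-RiemannHypothesis-19953; route F8 / hand-off H13 of the rh-explicit HANDOFF track,
`IDEAS-finite-rank.md` PART G7; RH-free; nothing here bears on RH — one window's sign has no bearing on RH)

* §1 `oneSignedWindow_of_evenConeDense` — EVEN cone density ⇒ `OneSignedWindow a` (every `a > 0`): even near-minimisers (`exists_seq_tendsto_sInf`),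
  cone replacements, compactness (`ConnesConsaniMoscovici2025_thm_3_6_holds`), `IsWeilEvenGroundState.of_tendsto`, closedness of the sign cone
  (`stub_aeNonneg_of_L2_limit`); the even-sector twin of `exists_oneSigned_of_coneDense`, no «even wins» hypothesis needed.
* §2 `oneSignedWindow_of_sourceCertificate` — **THE CERTIFICATE LEMMA** (typed target H13 of handoff-idea-3, hypotheses made honest): `0 < a`,
  `0 ≤ η < η′`, a profile `uN` continuous and `≥ 0` on `[−a, a]` whose certificate margin
  `Λ(y, r; η′) = ∫_{(−a,a),|x−y|>r} uN w(|x−y|) − η′(∫_{(−a,a),|x−y|>r} w(|x−y|)²)^{1/2} − 2(∫_{(−a,a)} uN cosh(x/2) + η′√(a + sinh a)) cosh(y/2)`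
  is positive at every `y ∈ (−a, a)` for some `r = r(y) > 0`, and a real-valued even-sector ground state `u` at `a` with `∫_{(−a,a)} (Re u − uN)² ≤ η²`
  ⟹ `OneSignedWindow a`. Versus the sketch `CertificateLemma` (HOME/handoff/idea-3/g7/SourceCertificate.lean): (i) certificate on the OPEN SYMMETRIC
  window (the margin is even in `y`; the sketch had `y ∈ [0, a)`); (ii) radius `η′` STRICTLY above the proximity radius `η` (near-minimisers reach `uN`
  only up to `η + o(1)`; idea-3: «certify at η_cert and ask (s2) for η < η_cert»); (iii) `uN` continuous on the closed window (cosine profiles are);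
  (iv) polar coefficient `η′`, not `2η′`. PROOF = route (A) of G7-1 (3): the real parts of `u`'s even minimising sequence, renormalised, are even real
  tests `G_n` with `Re Q(G_n) → ε_ev(a)` and `‖G_n − uN‖_{L²(−a,a)}` eventually `≤ η′`; by `source_ge_certMargin_of_sq_close` each late `G_n` is
  SOURCE-POSITIVE, `swu_evenConeDense_of_sourcePositive` gives even cone density, and §1 concludes.

What remains for THEOREM `OneSignedWindow (7/20)` (route F9, the certified lane's): a concrete cosine profile `uN` with an interval-arithmetic proof of
the margin positivity on `(−7/20, 7/20)` at some `η′`, and the proximity hypothesis at some `η < η′` via `evenTwoLevelProximity`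
(`EvenSectorBartaEvenOneSignedWindowsTwoLevelProximity.lean`) from two-sided enclosures of the first two even levels.

References: E. Bombieri, Rend. Mat. Acc. Lincei (9) 11 (2000), §4 Problem 2, Thm 3, Thm 5, §9 Lemma 11 (`Bombieri2000Weil`); A. Connes, C. Consani,
H. Moscovici (2025), Thm 3.6 (compactness; tree `ConnesConsaniMoscovici2025_thm_3_6_holds`); this track, IDEAS-finite-rank.md PART G7.
-/

noncomputable section

set_option linter.dupNamespace false

open Set MeasureTheory Filter Complex
open scoped Real Topology

namespace Summit.RiemannHypothesis.RiemannHypothesis.Theorems.PolarPerronFrobenius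

open Literature.NumberTheory.LFunctions
open Literature.NumberTheory.LFunctions.ConnesVanSuijlekom
open Summit.RiemannHypothesis.RiemannHypothesis.Theorems.OddSector
  (isWeilTest_rePart isWeilTest_imPart tsupport_rePart_subset tsupport_imPart_subset integral_norm_sq_rePart_add_imPart
    re_weilQuadratic_eq_rePart_add_imPart)
open scoped ArithmeticFunction.vonMangoldt

/-! ## §1 Even cone density ⇒ a one-signed even-sector window -/

/-- **Even cone density ⇒ `OneSignedWindow a`** (RH-free, every `a > 0`). [cite: Bombieri2000Weil, §4 Thm 3 (compactness of minimising sequences), §9 Lemma 11 (parity)] -/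
theorem oneSignedWindow_of_evenConeDense {a : ℝ} (ha : 0 < a)
    (hcone : ∀ h : ℝ → ℂ, IsWeilTest h → tsupport h ⊆ Icc (-a) a → (∀ t, h (-t) = h t) →
      ∫ t, ‖h t‖ ^ 2 = (1 : ℝ) → ∀ δ : ℝ, 0 < δ →
        ∃ w : ℝ → ℂ, IsWeilTest w ∧ tsupport w ⊆ Icc (-a) a ∧ (∀ t, w (-t) = w t) ∧
          (∀ t, (w t).im = 0 ∧ 0 ≤ (w t).re) ∧ ∫ t, ‖w t‖ ^ 2 = (1 : ℝ) ∧
          (weilQuadratic w).re ≤ (weilQuadratic h).re + δ) :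
    OneSignedWindow a := by
  set S : Set ℝ := weilWindowSphereValues (fun g : ℝ → ℂ ↦ ∀ t, g (-t) = g t) a with hSdef
  have hne : S.Nonempty := weilWindowSphereValues_even_nonempty ha
  have hbdd : BddBelow S := bddBelow_weilWindowSphereValues _ a
  obtain ⟨x, -, hx, hmem⟩ := exists_seq_tendsto_sInf hne hbdd
  have hmem' : ∀ n, ∃ g : ℝ → ℂ, IsWeilTest g ∧ tsupport g ⊆ Icc (-a) a ∧ (∀ t, g (-t) = g t) ∧
      ∫ t : ℝ, ‖g t‖ ^ 2 = 1 ∧ x n = (weilQuadratic g).re := hmem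
  choose e he hes hev hen hxe using hmem'
  have hQe : Tendsto (fun n ↦ (weilQuadratic (e n)).re) atTop (𝓝 (weilEvenGroundEnergy a)) := by
    have hfun : (fun n ↦ (weilQuadratic (e n)).re) = x := funext fun n ↦ (hxe n).symm
    rw [hfun, weilEvenGroundEnergy_eq_sInf]
    exact hx
  have step : ∀ n : ℕ, ∃ w : ℝ → ℂ, IsWeilTest w ∧ tsupport w ⊆ Icc (-a) a ∧ (∀ t, w (-t) = w t) ∧
      (∀ t, (w t).im = 0 ∧ 0 ≤ (w t).re) ∧ ∫ t, ‖w t‖ ^ 2 = (1 : ℝ) ∧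
      (weilQuadratic w).re ≤ (weilQuadratic (e n)).re + 1 / ((n : ℝ) + 1) :=
    fun n ↦ hcone (e n) (he n) (hes n) (hev n) (hen n) _ (by positivity)
  choose w hw hws hwe hwr hwn hwQ using step
  have hlow : ∀ n, weilEvenGroundEnergy a ≤ (weilQuadratic (w n)).re := fun n ↦
    weilEvenGroundEnergy_le (hw n) (hws n) (hwe n) (hwn n)
  have hQw : Tendsto (fun n ↦ (weilQuadratic (w n)).re) atTop (𝓝 (weilEvenGroundEnergy a)) := by
    have h1 : Tendsto (fun n : ℕ ↦ (weilQuadratic (e n)).re + 1 / ((n : ℝ) + 1)) atTop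
        (𝓝 (weilEvenGroundEnergy a + 0)) := hQe.add tendsto_one_div_add_atTop_nhds_zero_nat
    rw [add_zero] at h1
    exact tendsto_of_tendsto_of_tendsto_of_le_of_le tendsto_const_nhds h1 hlow hwQ
  obtain ⟨u, hu, φ, hφ, hconv⟩ := ConnesConsaniMoscovici2025_thm_3_6_holds a ha w
    (fun n ↦ ⟨hw n, hws n, hwn n⟩) hQw.bddAbove_range
  have hgs : IsWeilEvenGroundState a u :=
    IsWeilEvenGroundState.of_tendsto hu (fun n ↦ ⟨hw _, hws _, hwe _, hwn _⟩) (hQw.comp hφ.tendsto_atTop) hconv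
  have hmem2 : ∀ n, MemLp (w (φ n)) 2 := fun n ↦ (hw (φ n)).memLp_two
  have hsign := stub_aeNonneg_of_L2_limit (fun n ↦ w (φ n)) u hmem2 hu (fun n t ↦ hwr (φ n) t) hconv
  exact ⟨u, hgs, hsign.mono fun t ht _ ↦ ht⟩

/-! ## §2 The certificate lemma -/

/-- The topological support of the complex cast of a real function is that of the function. [folklore] -/
theorem tsupport_ofReal_comp (h : ℝ → ℝ) : tsupport (fun t ↦ ((h t : ℝ) : ℂ)) = tsupport h := by
  unfold tsupport
  congr 1
  exact Function.support_comp_eq Complex.ofReal Complex.ofReal_eq_zero h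

set_option maxHeartbeats 1600000 in
/-- **THE L²-SOURCE CERTIFICATE LEMMA (RH-free).** Let `0 < a`, `0 ≤ η < η′`; let `uN` be continuous and `≥ 0` on `[−a, a]` with a positive
certificate margin at radius `η′` at every point of the open window (for some cut-off `r > 0` depending on the point); and let `u` be a
real-valued even-sector ground state at `a` with `∫_{(−a,a)} (Re u − uN)² ≤ η²`. Then `OneSignedWindow a`. [this track, IDEAS-finite-rank.md
PART G7-1 (2)–(3), route (A); cite: Bombieri2000Weil, §4 Problem 2, Thm 3, §9 Lemma 11] -/
theorem oneSignedWindow_of_sourceCertificate {a η η' : ℝ} {uN : ℝ → ℝ} (ha : 0 < a) (hη : 0 ≤ η) (hηη' : η < η')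
    (huc : ContinuousOn uN (Icc (-a) a)) (hu0 : ∀ x ∈ Icc (-a) a, 0 ≤ uN x)
    (hcert : ∀ y ∈ Ioo (-a) a, ∃ r : ℝ, 0 < r ∧
      0 < (∫ x in Ioo (-a) a, if r < |x - y| then uN x * weilArchDensity |x - y| else 0)
        - η' * Real.sqrt (∫ x in Ioo (-a) a, if r < |x - y| then weilArchDensity |x - y| ^ 2 else 0)
        - 2 * ((∫ x in Ioo (-a) a, uN x * Real.cosh (x / 2)) + η' * Real.sqrt (a + Real.sinh a)) * Real.cosh (y / 2))
    {u : ℝ → ℂ} (hu : IsWeilEvenGroundState a u) (hureal : ∀ t, (u t).im = 0)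
    (hclose : ∫ t in Ioo (-a) a, ((u t).re - uN t) ^ 2 ≤ η ^ 2) :
    OneSignedWindow a := by
  have hη' : 0 < η' := lt_of_le_of_lt hη hηη'
  set ε : ℝ := weilEvenGroundEnergy a with hε_def
  obtain ⟨g, hg, hQ, hL⟩ := hu.exists_tendsto
  have hum : MemLp u 2 := hu.memLp
  have hgm : ∀ n, MemLp (g n) 2 := fun n ↦ (hg n).1.memLp_two
  set e : ℕ → ℝ → ℂ := fun n t ↦ (((g n t).re : ℝ) : ℂ) with he_def
  set o : ℕ → ℝ → ℂ := fun n t ↦ (((g n t).im : ℝ) : ℂ) with ho_def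
  have het : ∀ n, IsWeilTest (e n) := fun n ↦ isWeilTest_rePart (hg n).1
  have hot : ∀ n, IsWeilTest (o n) := fun n ↦ isWeilTest_imPart (hg n).1
  have hes : ∀ n, tsupport (e n) ⊆ Icc (-a) a := fun n ↦ (tsupport_rePart_subset _).trans (hg n).2.1
  have hos : ∀ n, tsupport (o n) ⊆ Icc (-a) a := fun n ↦ (tsupport_imPart_subset _).trans (hg n).2.1
  have hee : ∀ n t, e n (-t) = e n t := fun n t ↦ by simp only [he_def, (hg n).2.2.1 t]
  have hoe : ∀ n t, o n (-t) = o n t := fun n t ↦ by simp only [ho_def, (hg n).2.2.1 t]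
  set N : ℕ → ℝ := fun n ↦ ∫ t, ‖e n t‖ ^ 2 with hN_def
  set M : ℕ → ℝ := fun n ↦ ∫ t, ‖o n t‖ ^ 2 with hM_def
  have hNM : ∀ n, N n + M n = 1 := fun n ↦ by
    have h := integral_norm_sq_rePart_add_imPart (hgm n)
    rw [(hg n).2.2.2] at h
    exact h
  have hM0 : ∀ n, 0 ≤ M n := fun n ↦ integral_nonneg fun _ ↦ by positivity
  have hMle : ∀ n, M n ≤ ∫ t, ‖g n t - u t‖ ^ 2 := by
    intro n
    refine integral_mono_of_nonneg (Eventually.of_forall fun t ↦ by positivity)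
      ((memLp_two_iff_integrable_sq_norm ((hgm n).sub hum).1).1 ((hgm n).sub hum)) (Eventually.of_forall fun t ↦ ?_)
    dsimp only
    have h1 : ‖o n t‖ = |(g n t - u t).im| := by
      simp only [ho_def, Complex.norm_real, Real.norm_eq_abs, Complex.sub_im, hureal t, sub_zero]
    rw [h1]
    exact pow_le_pow_left₀ (abs_nonneg _) (Complex.abs_im_le_norm _) 2
  have hMt : Tendsto M atTop (𝓝 0) :=
    tendsto_of_tendsto_of_tendsto_of_le_of_le tendsto_const_nhds hL hM0 hMle
  have hNt : Tendsto N atTop (𝓝 1) := by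
    have h1 : Tendsto (fun n ↦ 1 - M n) atTop (𝓝 (1 - 0)) := tendsto_const_nhds.sub hMt
    rw [sub_zero] at h1
    exact h1.congr fun n ↦ by linarith [hNM n]
  have hQsplit : ∀ n, (weilQuadratic (g n)).re = (weilQuadratic (e n)).re + (weilQuadratic (o n)).re := fun n ↦
    re_weilQuadratic_eq_rePart_add_imPart (hg n).1
  have hQo : ∀ n, ε * M n ≤ (weilQuadratic (o n)).re := fun n ↦
    mul_integral_le_re_of_sphere (hot n) fun c _ hnorm ↦
      weilEvenGroundEnergy_le ((hot n).const_mul c) (tsupport_mul_subset_right.trans (hos n))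
        (fun t ↦ by simp only [hoe n t]) hnorm
  have hQe_le : ∀ n, (weilQuadratic (e n)).re ≤ (weilQuadratic (g n)).re - ε * M n := fun n ↦ by
    linarith [hQsplit n, hQo n]
  have heL : Tendsto (fun n ↦ ∫ t, ‖e n t - u t‖ ^ 2) atTop (𝓝 0) := by
    refine tendsto_of_tendsto_of_tendsto_of_le_of_le tendsto_const_nhds hL
      (fun n ↦ integral_nonneg fun _ ↦ by positivity) fun n ↦ ?_
    refine integral_mono_of_nonneg (Eventually.of_forall fun t ↦ by positivity)
      ((memLp_two_iff_integrable_sq_norm ((hgm n).sub hum).1).1 ((hgm n).sub hum)) (Eventually.of_forall fun t ↦ ?_)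
    dsimp only
    have h1 : ‖e n t - u t‖ = |(g n t - u t).re| := by
      have hu_re : u t = (((u t).re : ℝ) : ℂ) := by
        apply Complex.ext <;> simp [hureal t]
      rw [hu_re]
      simp only [he_def, ← Complex.ofReal_sub, Complex.norm_real, Real.norm_eq_abs, Complex.sub_re, Complex.ofReal_re]
    rw [h1]
    exact pow_le_pow_left₀ (abs_nonneg _) (Complex.abs_re_le_norm _) 2
  set c : ℕ → ℝ := fun n ↦ (Real.sqrt (N n))⁻¹ with hc_def
  have hct : Tendsto c atTop (𝓝 1) := by
    have h1 : Tendsto (fun n ↦ Real.sqrt (N n)) atTop (𝓝 (Real.sqrt 1)) := (Real.continuous_sqrt.tendsto 1).comp hNt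
    rw [Real.sqrt_one] at h1
    have h2 := h1.inv₀ one_ne_zero
    rw [inv_one] at h2
    exact h2
  have hQG : ∀ δ : ℝ, 0 < δ → ∀ᶠ n in atTop, 0 < N n ∧ c n ^ 2 * (weilQuadratic (e n)).re ≤ ε + δ := by
    intro δ hδ
    have hT : Tendsto (fun n ↦ ((weilQuadratic (g n)).re - ε * M n) / N n) atTop (𝓝 ((ε - ε * 0) / 1)) :=
      ((hQ.sub (hMt.const_mul ε)).div hNt one_ne_zero)
    rw [mul_zero, sub_zero, div_one] at hT
    have hev1 : ∀ᶠ n in atTop, ((weilQuadratic (g n)).re - ε * M n) / N n < ε + δ :=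
      (tendsto_order.1 hT).2 _ (by linarith)
    have hev2 : ∀ᶠ n in atTop, 1 / 2 < N n := (tendsto_order.1 hNt).1 _ (by norm_num)
    filter_upwards [hev1, hev2] with n h1 h2
    have hNpos : 0 < N n := by linarith
    refine ⟨hNpos, ?_⟩
    have hc2 : c n ^ 2 = (N n)⁻¹ := by
      rw [hc_def]; dsimp only; rw [inv_pow, Real.sq_sqrt hNpos.le]
    rw [hc2, inv_mul_eq_div]
    exact ((div_le_div_of_nonneg_right (hQe_le n) hNpos.le).trans h1.le)
  have hD : Tendsto (fun n ↦ ∫ t, ‖(c n : ℂ) * e n t - u t‖ ^ 2) atTop (𝓝 0) := by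
    have hbound : ∀ n, ∫ t, ‖(c n : ℂ) * e n t - u t‖ ^ 2 ≤ 2 * ((c n - 1) ^ 2 * N n) + 2 * ∫ t, ‖e n t - u t‖ ^ 2 := by
      intro n
      have i1 : Integrable fun t ↦ ‖e n t - u t‖ ^ 2 :=
        (memLp_two_iff_integrable_sq_norm (((het n).memLp_two).sub hum).1).1 (((het n).memLp_two).sub hum)
      have i2 : Integrable fun t ↦ ‖e n t‖ ^ 2 :=
        (memLp_two_iff_integrable_sq_norm (het n).memLp_two.1).1 (het n).memLp_two
      have i3 : Integrable fun t ↦ ‖(c n : ℂ) * e n t - u t‖ ^ 2 :=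
        (memLp_two_iff_integrable_sq_norm ((((het n).const_mul (c n : ℂ)).memLp_two).sub hum).1).1
          ((((het n).const_mul (c n : ℂ)).memLp_two).sub hum)
      calc ∫ t, ‖(c n : ℂ) * e n t - u t‖ ^ 2
          ≤ ∫ t, (2 * ((c n - 1) ^ 2 * ‖e n t‖ ^ 2) + 2 * ‖e n t - u t‖ ^ 2) := by
            refine integral_mono i3 (((i2.const_mul _).const_mul _).add (i1.const_mul _)) fun t ↦ ?_
            have e1 : (c n : ℂ) * e n t - u t = ((c n - 1 : ℝ) : ℂ) * e n t + (e n t - u t) := by push_cast; ring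
            rw [e1]
            have h1 := norm_add_le (((c n - 1 : ℝ) : ℂ) * e n t) (e n t - u t)
            rw [norm_mul, Complex.norm_real, Real.norm_eq_abs] at h1
            have h2 : 0 ≤ ‖((c n - 1 : ℝ) : ℂ) * e n t + (e n t - u t)‖ := norm_nonneg _
            nlinarith only [h1, h2, norm_nonneg (e n t), norm_nonneg (e n t - u t),
              abs_nonneg (c n - 1), sq_nonneg (|c n - 1| * ‖e n t‖ - ‖e n t - u t‖), sq_abs (c n - 1)]
        _ = 2 * ((c n - 1) ^ 2 * N n) + 2 * ∫ t, ‖e n t - u t‖ ^ 2 := by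
            rw [integral_add (((i2.const_mul _).const_mul _)) (i1.const_mul _), integral_const_mul, integral_const_mul,
              integral_const_mul]
    have hlim : Tendsto (fun n ↦ 2 * ((c n - 1) ^ 2 * N n) + 2 * ∫ t, ‖e n t - u t‖ ^ 2) atTop (𝓝 0) := by
      have h1 : Tendsto (fun n ↦ (c n - 1) ^ 2 * N n) atTop (𝓝 ((1 - 1) ^ 2 * 1)) :=
        ((hct.sub tendsto_const_nhds).pow 2).mul hNt
      rw [sub_self, zero_pow two_ne_zero, zero_mul] at h1
      have := (h1.const_mul 2).add (heL.const_mul 2)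
      simpa using this
    exact tendsto_of_tendsto_of_tendsto_of_le_of_le tendsto_const_nhds hlim
      (fun n ↦ integral_nonneg fun _ ↦ by positivity) hbound
  obtain ⟨U, hU⟩ := isCompact_Icc.exists_bound_of_continuousOn huc
  have hU' : ∀ x ∈ Ioo (-a) a, |uN x| ≤ U := fun x hx ↦ by simpa [Real.norm_eq_abs] using hU x (Ioo_subset_Icc_self hx)
  have hU0 : 0 ≤ U := (abs_nonneg _).trans (hU' 0 ⟨by linarith, ha⟩)
  have hmeas_uN : AEStronglyMeasurable uN (volume.restrict (Ioo (-a) a)) :=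
    (huc.mono Ioo_subset_Icc_self).aestronglyMeasurable measurableSet_Ioo
  have hmeas_ure : AEStronglyMeasurable (fun t ↦ (u t).re) (volume.restrict (Ioo (-a) a)) :=
    (Complex.continuous_re.comp_aestronglyMeasurable hum.1).restrict
  have hfin : volume (Ioo (-a) a) ≠ ⊤ := by rw [Real.volume_Ioo]; exact ENNReal.ofReal_ne_top
  haveI : IsFiniteMeasure (volume.restrict (Ioo (-a) a)) := by
    refine ⟨?_⟩
    rw [Measure.restrict_apply_univ, Real.volume_Ioo]
    exact ENNReal.ofReal_lt_top
  have hu2 : IntegrableOn (fun t ↦ ‖u t‖ ^ 2) (Ioo (-a) a) :=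
    ((memLp_two_iff_integrable_sq_norm hum.1).1 hum).integrableOn
  have hI2 : IntegrableOn (fun t ↦ ((u t).re - uN t) ^ 2) (Ioo (-a) a) := by
    have hconst : IntegrableOn (fun _ : ℝ ↦ (2 * U ^ 2 : ℝ)) (Ioo (-a) a) := integrableOn_const hfin
    refine Integrable.mono' ((hu2.const_mul 2).add hconst)
      ((hmeas_ure.sub hmeas_uN).pow 2) (ae_restrict_Ioo_of_forall fun t ht ↦ ?_)
    rw [Real.norm_eq_abs, abs_of_nonneg (sq_nonneg _)]
    have h1 := Complex.abs_re_le_norm (u t)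
    have h2 := hU' t ht
    have h3 : (u t).re ^ 2 ≤ ‖u t‖ ^ 2 := by
      rw [← sq_abs ((u t).re)]; exact pow_le_pow_left₀ (abs_nonneg _) h1 2
    have h4 : (uN t) ^ 2 ≤ U ^ 2 := by
      rw [← sq_abs (uN t)]; exact pow_le_pow_left₀ (abs_nonneg _) h2 2
    change ((u t).re - uN t) ^ 2 ≤ 2 * ‖u t‖ ^ 2 + 2 * U ^ 2
    nlinarith only [h3, h4, sq_nonneg ((u t).re + uN t)]
  /- ### the source-positive even real near-minimisers: hypothesis `H` of `swu_evenConeDense_of_sourcePositive` -/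
  have H : ∀ f : ℝ → ℝ, IsWeilTest (fun t ↦ ((f t : ℝ) : ℂ)) →
      tsupport (fun t ↦ ((f t : ℝ) : ℂ)) ⊆ Icc (-a) a → (∀ t, f (-t) = f t) →
      ∫ t, ‖((f t : ℝ) : ℂ)‖ ^ 2 = 1 → ∀ δ : ℝ, 0 < δ →
        ∃ G : ℝ → ℝ, IsWeilTest (fun t ↦ ((G t : ℝ) : ℂ)) ∧
          tsupport (fun t ↦ ((G t : ℝ) : ℂ)) ⊆ Icc (-a) a ∧ (∀ t, G (-t) = G t) ∧
          ∫ t, ‖((G t : ℝ) : ℂ)‖ ^ 2 = 1 ∧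
          (weilQuadratic fun t ↦ ((G t : ℝ) : ℂ)).re ≤ (weilQuadratic fun t ↦ ((f t : ℝ) : ℂ)).re + δ ∧
          (∀ y, G y < 0 → 0 ≤ (∫ x, max (G x) 0 * weilArchDensity |x - y|) +
            (∑ n ∈ weilPrimeIndex a, (Λ n : ℝ) / Real.sqrt n *
              (max (G (y + Real.log n)) 0 + max (G (y - Real.log n)) 0)) -
            2 * ∫ x, max (G x) 0 * Real.cosh ((x - y) / 2)) := by
    intro f hf hfs hfe hf1 δ hδ
    set gap : ℝ := η' ^ 2 - η ^ 2 with hgap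
    have hgap0 : 0 < gap := by rw [hgap]; nlinarith [hηη', hη]
    set θ : ℝ := gap / (2 * (η ^ 2 + 1)) with hθ_def
    have hθ : 0 < θ := by rw [hθ_def]; positivity
    have hθη : θ * η ^ 2 ≤ gap / 2 := by
      rw [hθ_def]
      rw [div_mul_eq_mul_div, div_le_div_iff₀ (by positivity) (by norm_num)]
      nlinarith [sq_nonneg η, hgap0]
    set bound : ℝ := (gap / 2) / (1 + θ⁻¹) with hbound_def
    have hbound : 0 < bound := by rw [hbound_def]; positivity
    have hevD : ∀ᶠ n in atTop, ∫ t, ‖(c n : ℂ) * e n t - u t‖ ^ 2 < bound := (tendsto_order.1 hD).2 _ hbound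
    obtain ⟨n, ⟨hNpos, hQn⟩, hDn⟩ := ((hQG δ hδ).and hevD).exists
    set G : ℝ → ℝ := fun t ↦ c n * (g n t).re with hG_def
    have hcpos : 0 < c n := by rw [hc_def]; exact inv_pos.2 (Real.sqrt_pos.2 hNpos)
    have hGcast : (fun t ↦ ((G t : ℝ) : ℂ)) = fun t ↦ (c n : ℂ) * e n t := by
      funext t; simp only [hG_def, he_def]; push_cast; ring
    have hGt : IsWeilTest (fun t ↦ ((G t : ℝ) : ℂ)) := by rw [hGcast]; exact (het n).const_mul _
    have hGs : tsupport (fun t ↦ ((G t : ℝ) : ℂ)) ⊆ Icc (-a) a := by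
      rw [hGcast]; exact tsupport_mul_subset_right.trans (hes n)
    have hGe : ∀ t, G (-t) = G t := fun t ↦ by simp only [hG_def, (hg n).2.2.1 t]
    have hG1 : ∫ t, ‖((G t : ℝ) : ℂ)‖ ^ 2 = 1 := by
      have h1 : ∀ t, ‖((G t : ℝ) : ℂ)‖ ^ 2 = c n ^ 2 * ‖e n t‖ ^ 2 := fun t ↦ by
        simp only [hG_def, he_def, Complex.norm_real, Real.norm_eq_abs, abs_mul, abs_of_pos hcpos, mul_pow]
      simp only [h1]
      rw [integral_const_mul]
      change c n ^ 2 * N n = 1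
      rw [hc_def]; dsimp only
      rw [inv_pow, Real.sq_sqrt hNpos.le, inv_mul_cancel₀ hNpos.ne']
    have hGQ : (weilQuadratic fun t ↦ ((G t : ℝ) : ℂ)).re = c n ^ 2 * (weilQuadratic (e n)).re := by
      rw [hGcast, weilQuadratic_const_mul, Complex.normSq_ofReal, Complex.re_ofReal_mul]; ring
    have hGQ' : (weilQuadratic fun t ↦ ((G t : ℝ) : ℂ)).re ≤ (weilQuadratic fun t ↦ ((f t : ℝ) : ℂ)).re + δ := by
      rw [hGQ]
      have := weilEvenGroundEnergy_le hf hfs (fun t ↦ by simp only [hfe t]) hf1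
      linarith only [this, hQn]
    have hGc : Continuous G := continuous_const.mul (Complex.continuous_re.comp (hg n).1.1.continuous)
    have hGs' : tsupport G ⊆ Icc (-a) a := by rw [← tsupport_ofReal_comp]; exact hGs
    obtain ⟨Bn, hBn⟩ := ((hg n).1.2.norm).exists_bound_of_continuous (hg n).1.1.continuous.norm  -- bound on ‖gₙ‖
    have hGb : ∀ t, |G t| ≤ c n * Bn := fun t ↦ by
      rw [hG_def]; dsimp only
      rw [abs_mul, abs_of_pos hcpos]
      refine mul_le_mul_of_nonneg_left ((Complex.abs_re_le_norm _).trans ?_) hcpos.le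
      simpa using hBn t
    have hI1 : IntegrableOn (fun t ↦ (G t - uN t) ^ 2) (Ioo (-a) a) := by
      have hm : AEStronglyMeasurable (fun t ↦ (G t - uN t) ^ 2) (volume.restrict (Ioo (-a) a)) :=
        (hGc.aestronglyMeasurable.sub hmeas_uN).pow 2
      refine integrableOn_Ioo_of_bounded hm (C := (c n * Bn + U) ^ 2) fun t ht ↦ ?_
      rw [abs_of_nonneg (sq_nonneg _)]
      have h1 : |G t - uN t| ≤ c n * Bn + U := (abs_sub _ _).trans (add_le_add (hGb t) (hU' t ht))
      rw [← sq_abs (G t - uN t)]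
      exact pow_le_pow_left₀ (abs_nonneg _) h1 2
    have hI3 : IntegrableOn (fun t ↦ (G t - (u t).re) ^ 2) (Ioo (-a) a) := by
      have hdom : IntegrableOn (fun t ↦ ‖(c n : ℂ) * e n t - u t‖ ^ 2) (Ioo (-a) a) :=
        ((memLp_two_iff_integrable_sq_norm ((((het n).const_mul (c n : ℂ)).memLp_two).sub hum).1).1
          ((((het n).const_mul (c n : ℂ)).memLp_two).sub hum)).integrableOn
      refine Integrable.mono' hdom ((hGc.aestronglyMeasurable.sub hmeas_ure).pow 2)
        (ae_restrict_Ioo_of_forall fun t _ ↦ ?_)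
      rw [Real.norm_eq_abs, abs_of_nonneg (sq_nonneg _)]
      have h1 : |G t - (u t).re| ≤ ‖(c n : ℂ) * e n t - u t‖ := by
        have : G t - (u t).re = ((c n : ℂ) * e n t - u t).re := by
          simp only [hG_def, he_def, Complex.sub_re, Complex.mul_re, Complex.ofReal_re, Complex.ofReal_im, mul_zero, sub_zero]
        rw [this]; exact Complex.abs_re_le_norm _
      have h2 : (G t - (u t).re) ^ 2 ≤ ‖(c n : ℂ) * e n t - u t‖ ^ 2 := by
        rw [← sq_abs (G t - (u t).re)]; exact pow_le_pow_left₀ (abs_nonneg _) h1 2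
      exact h2
    have hwin3 : ∫ t in Ioo (-a) a, (G t - (u t).re) ^ 2 ≤ ∫ t, ‖(c n : ℂ) * e n t - u t‖ ^ 2 := by
      have hdomI : Integrable fun t ↦ ‖(c n : ℂ) * e n t - u t‖ ^ 2 :=
        (memLp_two_iff_integrable_sq_norm ((((het n).const_mul (c n : ℂ)).memLp_two).sub hum).1).1
          ((((het n).const_mul (c n : ℂ)).memLp_two).sub hum)
      calc ∫ t in Ioo (-a) a, (G t - (u t).re) ^ 2 ≤ ∫ t in Ioo (-a) a, ‖(c n : ℂ) * e n t - u t‖ ^ 2 := by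
            refine setIntegral_mono_on hI3 hdomI.integrableOn measurableSet_Ioo fun t _ ↦ ?_
            have h1 : |G t - (u t).re| ≤ ‖(c n : ℂ) * e n t - u t‖ := by
              have : G t - (u t).re = ((c n : ℂ) * e n t - u t).re := by
                simp only [hG_def, he_def, Complex.sub_re, Complex.mul_re, Complex.ofReal_re, Complex.ofReal_im, mul_zero, sub_zero]
              rw [this]; exact Complex.abs_re_le_norm _
            rw [← sq_abs (G t - (u t).re)]; exact pow_le_pow_left₀ (abs_nonneg _) h1 2
        _ ≤ ∫ t, ‖(c n : ℂ) * e n t - u t‖ ^ 2 :=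
            setIntegral_le_integral hdomI (Eventually.of_forall fun t ↦ by positivity)
    have hdistG : ∫ t in Ioo (-a) a, (G t - uN t) ^ 2 ≤ η' ^ 2 := by
      have hpt : ∀ t ∈ Ioo (-a) a, (G t - uN t) ^ 2 ≤
          (1 + θ) * ((u t).re - uN t) ^ 2 + (1 + θ⁻¹) * (G t - (u t).re) ^ 2 := by
        intro t _
        set x := (u t).re - uN t
        set z := G t - (u t).re
        have e1 : G t - uN t = z + x := by ring
        rw [e1]
        have hkey : 2 * z * x ≤ θ * x ^ 2 + θ⁻¹ * z ^ 2 := by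
          have h2 : 0 ≤ (θ * x - z) ^ 2 / θ := div_nonneg (sq_nonneg _) hθ.le
          have e2 : (θ * x - z) ^ 2 / θ = θ * x ^ 2 - 2 * z * x + θ⁻¹ * z ^ 2 := by
            field_simp
            ring
          linarith only [h2, e2]
        nlinarith only [hkey]
      have hθ1 : (0 : ℝ) ≤ 1 + θ := by linarith only [hθ]
      have hθ2 : (0 : ℝ) ≤ 1 + θ⁻¹ := by have := inv_pos.2 hθ; linarith only [this]
      have h1θ : (1 + θ) * ∫ t in Ioo (-a) a, ((u t).re - uN t) ^ 2 ≤ (1 + θ) * η ^ 2 :=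
        mul_le_mul_of_nonneg_left hclose hθ1
      have h2θ : (1 + θ⁻¹) * ∫ t in Ioo (-a) a, (G t - (u t).re) ^ 2 ≤ (1 + θ⁻¹) * bound :=
        mul_le_mul_of_nonneg_left (hwin3.trans hDn.le) hθ2
      have hIsum : IntegrableOn (fun t ↦ (1 + θ) * ((u t).re - uN t) ^ 2 + (1 + θ⁻¹) * (G t - (u t).re) ^ 2) (Ioo (-a) a) :=
        (hI2.const_mul (1 + θ)).add (hI3.const_mul (1 + θ⁻¹))
      have hsplit : ∫ t in Ioo (-a) a, ((1 + θ) * ((u t).re - uN t) ^ 2 + (1 + θ⁻¹) * (G t - (u t).re) ^ 2) =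
          ((1 + θ) * ∫ t in Ioo (-a) a, ((u t).re - uN t) ^ 2) + (1 + θ⁻¹) * ∫ t in Ioo (-a) a, (G t - (u t).re) ^ 2 := by
        rw [integral_add (hI2.const_mul (1 + θ)) (hI3.const_mul (1 + θ⁻¹)), integral_const_mul, integral_const_mul]
      have hfinal : (1 + θ) * η ^ 2 + (1 + θ⁻¹) * bound ≤ η' ^ 2 := by
        have hne : (1 + θ⁻¹) ≠ 0 := ne_of_gt (by have := inv_pos.2 hθ; linarith only [this])
        have e3 : (1 + θ⁻¹) * bound = gap / 2 := by
          rw [hbound_def, mul_comm, div_mul_cancel₀ _ hne]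
        rw [e3]
        nlinarith only [hθη, hgap, hθ, sq_nonneg η]
      calc ∫ t in Ioo (-a) a, (G t - uN t) ^ 2
          ≤ ∫ t in Ioo (-a) a, ((1 + θ) * ((u t).re - uN t) ^ 2 + (1 + θ⁻¹) * (G t - (u t).re) ^ 2) :=
            setIntegral_mono_on hI1 hIsum measurableSet_Ioo hpt
        _ = ((1 + θ) * ∫ t in Ioo (-a) a, ((u t).re - uN t) ^ 2) + (1 + θ⁻¹) * ∫ t in Ioo (-a) a, (G t - (u t).re) ^ 2 :=
            hsplit
        _ ≤ (1 + θ) * η ^ 2 + (1 + θ⁻¹) * bound := add_le_add h1θ h2θ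
        _ ≤ η' ^ 2 := hfinal
    refine ⟨G, hGt, hGs, hGe, hG1, hGQ', fun y hGy ↦ ?_⟩
    have hyI : y ∈ Ioo (-a) a := by
      by_contra hy
      exact absurd (eq_zero_of_notMem_Ioo hGc hGs' hy) hGy.ne
    obtain ⟨r, hr, hmargin⟩ := hcert y hyI
    have hbd := source_ge_certMargin_of_sq_close (f := G) (uN := uN) ha hη'.le hr hGc hGs' hGe huc hu0 hdistG hGy
    linarith only [hbd, hmargin]
  exact oneSignedWindow_of_evenConeDense ha (swu_evenConeDense_of_sourcePositive ha H)

end Summit.RiemannHypothesis.RiemannHypothesis.Theorems.PolarPerronFrobenius
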